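import Summits.QuantumFields.YangMills.Theorems.LuscherReductionTwistedTraceScalingQuaternionStep
import Summits.QuantumFields.YangMills.Theorems.LuscherReductionTwistedTraceScalingCovariantCurl
import Summits.QuantumFields.YangMills.Theorems.FemtoTransferGapRungW1upAlgebra
import Summits.QuantumFields.YangMills.Theorems.LuscherReductionOneSiteLevelsKacChart
import HarnessLib

/-!
# ALMOST-COMMUTING `SU(2)` ELEMENTS ARE `√defect`-CLOSE TO COMMUTING ONES: the `S^{1/4}` law of the valley geometry, pair and triple versions
# (lane A of S-BASE, crux `TwistedTraceScaling` stmt-QuantumFields-20203; first brick of the Łojasiewicz half of `ValleyGeomAt`, design note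
# `pub/ym-fleet/ym-luscher-20007-p1/COARSE-DESIGN.md` §16)

The commutator plaquette of `A, B ∈ SU(2)` has action `1 − ½Re tr(ABA⁻¹B⁻¹) = 2|u_A × u_B|²` (`two_sub_re_trace_comm_eq_cross`), so «almost flat» constant
configurations are «almost commuting» links, with DEFECT `ε = |u_A × u_B| = √(S/2)`.  This file proves the elementary stability statement behind the disprover's
surviving brick «`S^{1/4}` to FLAT» (R8 K2(i)): almost-commuting elements are `2√ε`-close (Frobenius) to GENUINELY commuting ones — indeed to elements of ONE
maximal torus.  Quaternion case analysis: if `|u_A|² ≤ ε` move `A` to the centre `±1` (cost `‖A ∓ 1‖² = 4(1 − |a|) ≤ 4|u_A|² ≤ 4ε`); otherwise project `u_B` onto the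
axis of `u_A` (`|u_B^⊥|² = |u_A × u_B|²/|u_A|² ≤ ε`, cost `≤ 4ε`).
* `commute_of_vecPart_smul` (via the tree's `eq_of_scalarPart_eq_of_vecPart_eq`) (parallel vector parts commute), `frobNorm_sub_sq_eq` (`‖U − V‖² = 4(1 − u₀v₀ − u·v)`), `axisElem` (the element with
  prescribed axis component and sign);
* ★★ `exists_commuting_pair_near` — `∃ A' B'`, `A'B' = B'A'`, `‖A − A'‖² ≤ 4ε`, `‖B − B'‖² ≤ 4ε`, `ε = |u_A × u_B|`;
* ★★ `exists_common_axis_triple_near` — for `A : Fin 3 → SU(2)` with pairwise defects `|u_i × u_j| ≤ ε`: `∃ n, A'` with every `vecPart(A'_i) ∈ ℝ·n` (hence pairwise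
  commuting, `commute_of_common_axis`) and `‖A_i − A'_i‖² ≤ 4ε` — the holonomy triple of an almost-flat configuration is `2√ε`-close to a commuting (one-torus) triple.
In the valley (`S ≤ 2η`): `ε ≍ √η`, distance `≍ η^{1/4}` — the sharp exponent of R8.
HONEST FRAMING: quaternion algebra; a brick for `ValleyGeomAt` (C3c-LOW) of a stub lane of a child of the CONDITIONAL reduction route (femto rung R2b1); not Clay.
-/

set_option autoImplicit false

noncomputable section

open Matrix Real
open scoped Matrix Quaternion
open Literature.MathematicalPhysics.QuantumFieldTheory
open Literature.MathematicalPhysics.QuantumLattice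

namespace Summit.QuantumFields.YangMills.Theorems.FemtoTransferGap.TwoLattice.Flat

open Summit.QuantumFields.YangMills.Theorems.FemtoTransferGap
open Summit.QuantumFields.YangMills.Theorems.FemtoTransferGap.TwoLattice
open Summit.QuantumFields.YangMills.Theorems.FemtoTransferGap.TwoLattice.Cov

/-! ## §1 Quaternion bookkeeping -/

/-- Elements with PARALLEL vector parts commute: `vecPart B = t • vecPart A ⇒ AB = BA`. [cite: BrockerTomDieck1985, I (1.10)] -/
theorem commute_of_vecPart_smul {A B : SU2} {t : ℝ} (h : vecPart B = t • vecPart A) : A * B = B * A := by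
  refine eq_of_scalarPart_eq_of_vecPart_eq ?_ ?_
  · rw [scalarPart_mul, scalarPart_mul, mul_comm, dotProduct_comm]
  · rw [vecPart_mul, vecPart_mul, h]
    have h1 : vecPart A ⨯₃ (t • vecPart A) = 0 := by rw [LinearMap.map_smul, cross_self, smul_zero]
    have h2 : (t • vecPart A) ⨯₃ vecPart A = 0 := by rw [LinearMap.map_smul₂, cross_self, smul_zero]
    rw [h1, h2]; abel

/-- Elements whose vector parts lie on a common axis commute. [cite: BrockerTomDieck1985, I (1.10)] -/
theorem commute_of_common_axis {A B : SU2} {n : Fin 3 → ℝ} {s t : ℝ} (hA : vecPart A = s • n) (hB : vecPart B = t • n) : A * B = B * A := by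
  by_cases hs : s = 0
  · -- `A` is central-like: vector part zero
    refine (commute_of_vecPart_smul (A := B) (B := A) (t := 0) ?_).symm
    rw [hA, hs, zero_smul, zero_smul]
  · exact commute_of_vecPart_smul (t := t / s) (by rw [hB, hA, smul_smul, div_mul_cancel₀ _ hs])

/-- `‖U − V‖_F² = 4(1 − u₀v₀ − u·v)` for `U, V ∈ SU(2)`. [folklore] -/
theorem frobNorm_sub_sq_eq (U V : SU2) :
    frobNorm ((U : Matrix (Fin 2) (Fin 2) ℂ) - (V : Matrix (Fin 2) (Fin 2) ℂ)) ^ 2 = 4 * (1 - scalarPart U * scalarPart V - vecPart U ⬝ᵥ vecPart V) := by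
  rw [frobNorm_sub_eq_mul_inv, frobNorm_sub_one_sq_eq_scalarPart, scalarPart_mul, scalarPart_inv, vecPart_inv, dotProduct_neg]
  ring

/-- **The element with prescribed vector part and sign of the scalar part**: `axisElem pos w` has `vecPart = w` and `scalarPart = ±√(1 − |w|²)`. [folklore] -/
def axisElem (pos : Bool) (w : Fin 3 → ℝ) : SU2 := if pos then chartSU2 w else negOne * chartSU2 (-w)

/-- Parts of `axisElem` (`|w|² ≤ 1`). [folklore] -/
theorem axisElem_parts (pos : Bool) {w : Fin 3 → ℝ} (hw : ∑ a, w a ^ 2 ≤ 1) :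
    vecPart (axisElem pos w) = w ∧ scalarPart (axisElem pos w) = (if pos then 1 else -1) * Real.sqrt (1 - ∑ a, w a ^ 2) := by
  unfold axisElem
  cases pos
  · simp only [Bool.false_eq_true, if_false]
    have hw' : ∑ a, (-w) a ^ 2 ≤ 1 := by simpa using hw
    refine ⟨by rw [vecPart_negOne_mul, vecPart_chartSU2 hw', neg_neg], ?_⟩
    rw [scalarPart_negOne_mul, scalarPart_chartSU2 hw']
    simp
  · simp only [if_true]
    exact ⟨vecPart_chartSU2 hw, by rw [scalarPart_chartSU2 hw, one_mul]⟩

/-- `|u|² ≤ 1` for a vector part, as a hypothesis shape. [folklore] -/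
theorem sum_sq_smul_le_one {u : Fin 3 → ℝ} (hu : ∑ a, u a ^ 2 ≤ 1) {c : ℝ} (hc : c ^ 2 ≤ 1) : ∑ a, (c • u) a ^ 2 ≤ 1 := by
  have e : ∑ a, (c • u) a ^ 2 = c ^ 2 * ∑ a, u a ^ 2 := by
    simp only [Pi.smul_apply, smul_eq_mul, mul_pow, Finset.mul_sum]
  rw [e]
  calc c ^ 2 * ∑ a, u a ^ 2 ≤ 1 * 1 := mul_le_mul hc hu (Finset.sum_nonneg fun a _ => sq_nonneg _) zero_le_one
    _ = 1 := one_mul _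

/-! ## §2 Moving one element: to the centre, or onto an axis -/

/-- **To the centre**: every `A` is within `‖A − Z‖² ≤ 4|u_A|²` of a central `Z ∈ {1, −1}` (with `vecPart Z = 0`). [folklore] -/
theorem exists_central_near (A : SU2) : ∃ Z : SU2, vecPart Z = 0 ∧
    frobNorm ((A : Matrix (Fin 2) (Fin 2) ℂ) - (Z : Matrix (Fin 2) (Fin 2) ℂ)) ^ 2 ≤ 4 * ∑ a, vecPart A a ^ 2 := by
  have hz : ∑ a, (0 : Fin 3 → ℝ) a ^ 2 = 0 := by simp
  have h0 : ∑ a, (0 : Fin 3 → ℝ) a ^ 2 ≤ 1 := by rw [hz]; norm_num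
  have hsq := scalarPart_sq_add A
  have hu0 : 0 ≤ ∑ a, vecPart A a ^ 2 := Finset.sum_nonneg fun a _ => sq_nonneg _
  have ha1 : scalarPart A ≤ 1 := by nlinarith
  have ha1' : -1 ≤ scalarPart A := by nlinarith
  by_cases ha : 0 ≤ scalarPart A
  · refine ⟨axisElem true 0, (axisElem_parts true h0).1, ?_⟩
    obtain ⟨hv, hs⟩ := axisElem_parts true h0
    rw [hz, sub_zero, Real.sqrt_one, mul_one] at hs
    simp only [if_true] at hs
    rw [frobNorm_sub_sq_eq, hv, hs, dotProduct_zero]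
    nlinarith [mul_nonneg ha (sub_nonneg.2 ha1)]
  · push Not at ha
    refine ⟨axisElem false 0, (axisElem_parts false h0).1, ?_⟩
    obtain ⟨hv, hs⟩ := axisElem_parts false h0
    rw [hz, sub_zero, Real.sqrt_one, mul_one] at hs
    simp only [Bool.false_eq_true, if_false] at hs
    rw [frobNorm_sub_sq_eq, hv, hs, dotProduct_zero]
    nlinarith [mul_nonneg (neg_nonneg.2 ha.le) (by linarith : (0:ℝ) ≤ 1 + scalarPart A)]

/-- Lagrange's identity for vector parts: `|u|²|v|² − (u·v)² = |u × v|²`. [folklore] -/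
theorem lagrange (u v : Fin 3 → ℝ) : (u ⬝ᵥ u) * (v ⬝ᵥ v) - (u ⬝ᵥ v) ^ 2 = (u ⨯₃ v) ⬝ᵥ (u ⨯₃ v) := by
  rw [cross_dot_cross, dotProduct_comm v u]; ring

/-- **Onto an axis**: if `|u_A|² > 0`, then `B` is within `‖B − B'‖² ≤ 4|u_A × u_B|²/|u_A|²` of an element `B'` with `vecPart B' = t • u_A`. [folklore] -/
theorem exists_on_axis_near (A B : SU2) (hA : 0 < ∑ a, vecPart A a ^ 2) :
    ∃ (B' : SU2) (t : ℝ), vecPart B' = t • vecPart A ∧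
      frobNorm ((B : Matrix (Fin 2) (Fin 2) ℂ) - (B' : Matrix (Fin 2) (Fin 2) ℂ)) ^ 2 ≤
        4 * ((vecPart A ⨯₃ vecPart B) ⬝ᵥ (vecPart A ⨯₃ vecPart B)) / ∑ a, vecPart A a ^ 2 := by
  set u := vecPart A with hu
  set v := vecPart B with hv
  set b := scalarPart B with hb
  have huu : u ⬝ᵥ u = ∑ a, u a ^ 2 := by simp [dotProduct, pow_two]
  have hvv : v ⬝ᵥ v = ∑ a, v a ^ 2 := by simp [dotProduct, pow_two]
  set t : ℝ := (u ⬝ᵥ v) / (u ⬝ᵥ u) with ht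
  have huu0 : 0 < u ⬝ᵥ u := by rw [huu]; exact hA
  -- the projection `t • u` has `|t u|² = (u·v)²/|u|² ≤ |v|²`
  have hproj : ∑ a, (t • u) a ^ 2 = (u ⬝ᵥ v) ^ 2 / (u ⬝ᵥ u) := by
    have e : ∑ a, (t • u) a ^ 2 = t ^ 2 * (u ⬝ᵥ u) := by
      rw [huu]; simp only [Pi.smul_apply, smul_eq_mul, mul_pow, Finset.mul_sum]
    rw [e, ht]; field_simp
  have hlag := lagrange u v
  have hcross0 : 0 ≤ (u ⨯₃ v) ⬝ᵥ (u ⨯₃ v) := by simp only [dotProduct]; exact Finset.sum_nonneg fun a _ => mul_self_nonneg _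
  have hproj_le : (u ⬝ᵥ v) ^ 2 / (u ⬝ᵥ u) ≤ v ⬝ᵥ v := by
    rw [div_le_iff₀ huu0]; nlinarith
  have hvle : v ⬝ᵥ v ≤ 1 := by rw [hvv, hv]; exact sum_vecPart_sq_le B
  have htu1 : ∑ a, (t • u) a ^ 2 ≤ 1 := by rw [hproj]; exact hproj_le.trans hvle
  -- the new element, same sign of the scalar part as `B`
  refine ⟨axisElem (decide (0 ≤ b)) (t • u), t, (axisElem_parts _ htu1).1, ?_⟩
  obtain ⟨hv', hs'⟩ := axisElem_parts (decide (0 ≤ b)) htu1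
  rw [frobNorm_sub_sq_eq, hv', hs', hproj]
  -- `v · (t u) = (u·v)²/|u|²`
  have hdot : v ⬝ᵥ (t • u) = (u ⬝ᵥ v) ^ 2 / (u ⬝ᵥ u) := by
    rw [dotProduct_smul, smul_eq_mul, ht, dotProduct_comm v u]; field_simp
  rw [hdot]
  -- `b · b' ≥ b²` where `b' = ±√(1 − |tu|²)` has the sign of `b` and `|b'| ≥ |b|`
  have hb2 : b ^ 2 = 1 - v ⬝ᵥ v := by rw [hvv, hv, hb, sum_vecPart_sq]; ring
  have hroot_ge : |b| ≤ Real.sqrt (1 - (u ⬝ᵥ v) ^ 2 / (u ⬝ᵥ u)) := by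
    rw [← Real.sqrt_sq_eq_abs]
    exact Real.sqrt_le_sqrt (by rw [hb2]; linarith)
  have hbb : b ^ 2 ≤ b * ((if decide (0 ≤ b) = true then 1 else -1) * Real.sqrt (1 - (u ⬝ᵥ v) ^ 2 / (u ⬝ᵥ u))) := by
    by_cases hb0 : 0 ≤ b
    · simp only [hb0, decide_true, if_true, one_mul]
      rw [abs_of_nonneg hb0] at hroot_ge
      nlinarith
    · push Not at hb0
      simp only [not_le.mpr hb0, decide_false, Bool.false_eq_true, if_false, neg_one_mul]
      rw [abs_of_neg hb0] at hroot_ge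
      nlinarith
  -- conclude: `4(1 − bb' − (u·v)²/|u|²) ≤ 4(1 − b² − (u·v)²/|u|²) = 4(|v|² − (u·v)²/|u|²) = 4|u×v|²/|u|²`
  have hkey : 1 - b ^ 2 - (u ⬝ᵥ v) ^ 2 / (u ⬝ᵥ u) = ((u ⨯₃ v) ⬝ᵥ (u ⨯₃ v)) / (u ⬝ᵥ u) := by
    rw [hb2, ← hlag]; field_simp; ring
  rw [← huu]
  have : 4 * (1 - b * ((if decide (0 ≤ b) = true then 1 else -1) * Real.sqrt (1 - (u ⬝ᵥ v) ^ 2 / (u ⬝ᵥ u))) - (u ⬝ᵥ v) ^ 2 / (u ⬝ᵥ u))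
      ≤ 4 * (1 - b ^ 2 - (u ⬝ᵥ v) ^ 2 / (u ⬝ᵥ u)) := by linarith
  refine this.trans (le_of_eq ?_)
  rw [hkey, mul_div_assoc]

/-! ## §3 Pairs -/

/-- ★★ **ALMOST-COMMUTING PAIRS ARE NEAR COMMUTING PAIRS**: for `A, B ∈ SU(2)` with defect `ε ≥ |u_A × u_B|` (i.e. commutator-plaquette action `≤ 2ε²`) there are COMMUTING
`A', B'` with `‖A − A'‖_F² ≤ 4ε` and `‖B − B'‖_F² ≤ 4ε`. [cite: Luscher1983, §2] [cite: BrockerTomDieck1985, I (1.10)] -/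
theorem exists_commuting_pair_near (A B : SU2) {ε : ℝ} (hε : Real.sqrt ((vecPart A ⨯₃ vecPart B) ⬝ᵥ (vecPart A ⨯₃ vecPart B)) ≤ ε) :
    ∃ A' B' : SU2, A' * B' = B' * A' ∧
      frobNorm ((A : Matrix (Fin 2) (Fin 2) ℂ) - (A' : Matrix (Fin 2) (Fin 2) ℂ)) ^ 2 ≤ 4 * ε ∧
      frobNorm ((B : Matrix (Fin 2) (Fin 2) ℂ) - (B' : Matrix (Fin 2) (Fin 2) ℂ)) ^ 2 ≤ 4 * ε := by
  set c := (vecPart A ⨯₃ vecPart B) ⬝ᵥ (vecPart A ⨯₃ vecPart B) with hc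
  have hc0 : 0 ≤ c := by rw [hc]; simp only [dotProduct]; exact Finset.sum_nonneg fun a _ => mul_self_nonneg _
  have hε0 : 0 ≤ ε := (Real.sqrt_nonneg _).trans hε
  have hcε : c ≤ ε ^ 2 := by
    have := Real.sq_sqrt hc0
    nlinarith [Real.sqrt_nonneg c]
  by_cases hsmall : ∑ a, vecPart A a ^ 2 ≤ ε
  · -- move `A` to the centre
    obtain ⟨Z, hZ, hdist⟩ := exists_central_near A
    refine ⟨Z, B, (commute_of_vecPart_smul (A := B) (B := Z) (t := 0) (by rw [hZ, zero_smul])).symm, by linarith, ?_⟩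
    rw [sub_self, frobNorm_zero]; nlinarith
  · -- project `B` onto the axis of `A`
    push Not at hsmall
    have hA : 0 < ∑ a, vecPart A a ^ 2 := hε0.trans_lt hsmall
    obtain ⟨B', t, hB', hdist⟩ := exists_on_axis_near A B hA
    refine ⟨A, B', commute_of_vecPart_smul hB', by rw [sub_self, frobNorm_zero]; nlinarith, hdist.trans ?_⟩
    rw [div_le_iff₀ hA]
    nlinarith

/-! ## §4 Triples: a common axis -/

/-- ★★ **ALMOST-COMMUTING TRIPLES ARE NEAR A COMMON TORUS**: if `A : Fin 3 → SU(2)` has pairwise defects `|u_i × u_j| ≤ ε`, there are an axis `n` and `A' : Fin 3 → SU(2)`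
with every `vecPart(A'_i)` a multiple of `n` (so the `A'_i` pairwise commute, `commute_of_common_axis`) and `‖A_i − A'_i‖_F² ≤ 4ε` for every `i`.
[cite: Luscher1983, §2] [cite: BrockerTomDieck1985, I (1.10)] -/
theorem exists_common_axis_triple_near (A : Fin 3 → SU2) {ε : ℝ}
    (hε : ∀ i j, Real.sqrt ((vecPart (A i) ⨯₃ vecPart (A j)) ⬝ᵥ (vecPart (A i) ⨯₃ vecPart (A j))) ≤ ε) :
    ∃ (n : Fin 3 → ℝ) (A' : Fin 3 → SU2), (∀ i, ∃ t : ℝ, vecPart (A' i) = t • n) ∧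
      ∀ i, frobNorm ((A i : Matrix (Fin 2) (Fin 2) ℂ) - (A' i : Matrix (Fin 2) (Fin 2) ℂ)) ^ 2 ≤ 4 * ε := by
  have hε0 : 0 ≤ ε := (Real.sqrt_nonneg _).trans (hε 0 0)
  have hcε : ∀ i j, (vecPart (A i) ⨯₃ vecPart (A j)) ⬝ᵥ (vecPart (A i) ⨯₃ vecPart (A j)) ≤ ε ^ 2 := fun i j => by
    have hc0 : 0 ≤ (vecPart (A i) ⨯₃ vecPart (A j)) ⬝ᵥ (vecPart (A i) ⨯₃ vecPart (A j)) := by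
      simp only [dotProduct]; exact Finset.sum_nonneg fun a _ => mul_self_nonneg _
    have := Real.sq_sqrt hc0
    nlinarith [hε i j, Real.sqrt_nonneg ((vecPart (A i) ⨯₃ vecPart (A j)) ⬝ᵥ (vecPart (A i) ⨯₃ vecPart (A j)))]
  -- the element with the largest vector part
  obtain ⟨i₀, -, hi₀⟩ := Finset.exists_max_image Finset.univ (fun i => ∑ a, vecPart (A i) a ^ 2) Finset.univ_nonempty
  by_cases hsmall : ∑ a, vecPart (A i₀) a ^ 2 ≤ ε
  · -- all to the centre
    have hall : ∀ i, ∑ a, vecPart (A i) a ^ 2 ≤ ε := fun i => (hi₀ i (Finset.mem_univ i)).trans hsmall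
    choose Z hZ hdZ using fun i => exists_central_near (A i)
    exact ⟨0, Z, fun i => ⟨0, by rw [hZ i, zero_smul]⟩, fun i => (hdZ i).trans (by linarith [hall i])⟩
  · push Not at hsmall
    have hA : 0 < ∑ a, vecPart (A i₀) a ^ 2 := hε0.trans_lt hsmall
    choose B' t hB' hdB using fun i => exists_on_axis_near (A i₀) (A i) hA
    refine ⟨vecPart (A i₀), B', fun i => ⟨t i, hB' i⟩, fun i => (hdB i).trans ?_⟩
    rw [div_le_iff₀ hA]
    nlinarith [hcε i₀ i]

end Summit.QuantumFields.YangMills.Theorems.FemtoTransferGap.TwoLattice.Flat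

end
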